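import Mathlib
import Literature.Analysis.FluidPDE.VectorCalculus
import Summits.NavierStokesRegularity.NavierStokesRegularity.Theorems.FilamentSkeletonRssSkeletonEquilibriumKernelIntegrable

/-!
# Growth bookkeeping: linear growth gives properness and kernel integrability

Composing stub `stub_growthBookkeeping` of line `Sketch` (crux `SkeletonEquilibrium`, thesis
`FilamentSkeletonRss`). The one-curve existence theorem of the line exports LINEAR GROWTH
`c |t| − C ≤ ‖X t‖` (`c > 0`) of the filament; this stub turns it back into
(i) `‖X t‖ → ∞` as `t → +∞`, (ii) `‖X t‖ → ∞` as `t → −∞`, and (iii) Bochner integrability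
on `ℝ` of the Rosenhead-regularised Biot–Savart integrand
`u ↦ ((‖y − X u‖² + e²)^{3/2})⁻¹ • X′(u) × (y − X u)` at every point `y`.

(i), (ii): `c |t| − C → ∞` along `atTop` and `atBot` and `‖X t‖` dominates it;
(iii) is the landed tools stub `stub_kernelIntegrable`.
-/

noncomputable section

open MeasureTheory Filter Topology
open Literature.Analysis.FluidPDE

namespace Summit.NavierStokesRegularity.NavierStokesRegularity.Theorems.SkeletonEquilibrium.Sketch
set_option linter.dupNamespace false

/-- Linear growth `c |u| − C ≤ ‖X u‖` with `c > 0` forces `‖X t‖ → ∞` along any filter `l`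
along which `|t| → ∞`. [folklore] -/
private theorem growth_tendsto_norm_of_abs {c C : ℝ} {X : ℝ → EuclideanSpace ℝ (Fin 3)}
    (hc : 0 < c) (hgrow : ∀ u, c * |u| - C ≤ ‖X u‖) {l : Filter ℝ}
    (habs : Tendsto (fun t : ℝ => |t|) l atTop) :
    Tendsto (fun t => ‖X t‖) l atTop := by
  have h1 : Tendsto (fun t : ℝ => c * |t| + -C) l atTop :=
    tendsto_atTop_add_const_right _ (-C) (habs.const_mul_atTop hc)
  exact tendsto_atTop_mono (fun t => by simpa [sub_eq_add_neg] using hgrow t) h1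

/-- **Composing stub** (`stub_growthBookkeeping`): for `e ≠ 0`, `c > 0` and a `C¹` curve
`X : ℝ → ℝ³` with `‖X′‖ ≤ 1` and linear growth `c |u| − C ≤ ‖X u‖`, the curve is proper in
both time directions (`‖X t‖ → ∞` along `atTop` and `atBot`) and the regularised Biot–Savart
integrand `u ↦ ((‖y − X u‖² + e²)^{3/2})⁻¹ • X′(u) × (y − X u)` is Bochner integrable on `ℝ`
at every point `y`. [folklore] -/
theorem stub_growthBookkeeping :
    ∀ (e c C : ℝ) (X : ℝ → EuclideanSpace ℝ (Fin 3)), e ≠ 0 → 0 < c → ContDiff ℝ 1 X →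
      (∀ u, ‖deriv X u‖ ≤ 1) → (∀ u, c * |u| - C ≤ ‖X u‖) →
      Tendsto (fun t => ‖X t‖) atTop atTop ∧ Tendsto (fun t => ‖X t‖) atBot atTop ∧
      ∀ y : EuclideanSpace ℝ (Fin 3), Integrable (fun u : ℝ =>
        ((‖y - X u‖ ^ 2 + e ^ 2) ^ (3 / 2 : ℝ))⁻¹ • cross (deriv X u) (y - X u)) := by
  intro e c C X he hc hX hdX hgrow
  exact ⟨growth_tendsto_norm_of_abs hc hgrow tendsto_abs_atTop_atTop,
    growth_tendsto_norm_of_abs hc hgrow tendsto_abs_atBot_atTop,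
    stub_kernelIntegrable e c C X he hc hX hdX hgrow⟩

end Summit.NavierStokesRegularity.NavierStokesRegularity.Theorems.SkeletonEquilibrium.Sketch
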